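import Summits.AtomisticToContinuum.Crystallization.Theorems.OverbindingBudgetAffineCompressedCutStepA
import Summits.AtomisticToContinuum.Crystallization.Theorems.OverbindingBudgetAffineCompressedCutGlue
import Summits.AtomisticToContinuum.Crystallization.Theorems.OverbindingBudgetAffineCompressedCutReadingA

/-!
# Overbinding budget, R4 «LR(r₁)» part XII — READING: every site of the exclusivity ball carries a stacking label = LAYER RIGIDITY LR(r₁)

Route `OverbindingBudget`, crux `RobustDefectLimitWindows`, open leaf `NearFieldSlackMinSecond 12 (1/25)` ⟸ 79K ⟸ LR(r₁ = 4, exclusivity ball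
`(106/25)·ν`, `ν = ν_i`).  The last rider of the layer-rigidity cone:

* ★ `read_site` — given the stacking datum (`ref`, `Cz`, `e` of «Glue».`stack_levels_record`) in a frame `B` (`β = 399/400`, `γ = 401/400`), a site
  `m` with `dist (y m) (y i) ≤ (106/25)ν` is READ: `B z = y m − y i` (`B` is onto), `‖z‖ ≤ (106/25)(400/399)`; the lens point `c` («Lens».`lens_point`),
  its level `ℓ ∈ [−5,4]` and fractional height `t` (`level_of_point`); `lens_dist` with origin `ref ℓ` and cap sign `e ℓ` gives a label `q = ref ℓ_q + x`
  (`ℓ_q ∈ {ℓ, ℓ+1}`, `x` a layer vector) within `√2/2` of `c`; `placement` + `cover_B` put `q − (2ℓ_q,2ℓ_q,2ℓ_q)` in the level box, so `q` labels an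
  established site `k` (datum); `y m` is within `γν(9/10 − ρ₀ + √2/2) + D₃₁ < (3/2 + 1/450)·0.9026ν` of `y k` (`reach_lens`), hence `m = k` or `y m` is a
  registered neighbour `f_k v` of `k`; a second-shell `v` is excluded by `first_shell_budget`/`shell_far`; a first-shell `v` charts to `V ∈ Cz ℓ_q`,
  `child_position` bounds `y m` against the label `q + V` by `Δ = D₃₁ + 10⁻⁴·1.0347ν + τ₃₁`; the level of `q + V` is `ℓ` or `ℓ+1` (`height_budget` +
  `slab_int`), so an up-cap `V` (`thsum 6`) occurs only at `ℓ_q = ℓ` and is `capv 1 (e ℓ_q) δ` (`cap_unique` with the up-cap record), a down-cap only at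
  `ℓ_q = ℓ+1` and is `capv (−1) (−e ℓ) δ` (down-cap record of «Levels»): in all cases `q + V = ref ℓ' + x'`, `ℓ' ∈ [−5,5]`, `x'` a layer vector.
* ★★★ `layer_rigidity_record` = LR(r₁): from the hypotheses of the run files at radius `12ν` and the framing of `A i` ONLY: a sign `s`, the frame
  `B = (ν•A i)∘Φ_s`, the stacking datum with all its established sites, `i ↦ 0` (level `0`), every site of the `(106/25)ν`-ball labelled by a stacking
  label up to `Δ < ν/2` with `ν_m ≥ 0.9967·0.9026ν`, and injectivity both ways (same label ⇒ same site: `record_numbers` clause 1; same site ⇒ same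
  label: `label_sep` + `label_sep_budget`).
-/

namespace Summit.AtomisticToContinuum.Crystallization.Theorems.OverbindingBudgetAffineCompressedCutReading

open Literature.Geometry.DiscreteGeometry (nearestDist nearestDist_nonneg fccTwoShellPattern hcpTwoShellPattern)
open Summit.AtomisticToContinuum.Crystallization.Theorems.OverbindingBudgetAffineCompressedCutKernel (T3 tsub tadd tsq thsum fccL fccNegL hcpL hcpAltL)
open Summit.AtomisticToContinuum.Crystallization.Theorems.OverbindingBudgetAffineCompressedCutCharts (mv mv_tsub norm_mv_sq norm_mv_eq_one_iff)
open Summit.AtomisticToContinuum.Crystallization.Theorems.OverbindingBudgetAffineCompressedCutEstablish (Estab site_eq_of_close child_position bond_exact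
  tadd_tsub_cancel)
open Summit.AtomisticToContinuum.Crystallization.Theorems.OverbindingBudgetAffineCompressedCutEstablishTwo (IsSign flipIso lower_flip)
open Summit.AtomisticToContinuum.Crystallization.Theorems.OverbindingBudgetAffineCompressedCutSeed (InLayer)
open Summit.AtomisticToContinuum.Crystallization.Theorems.OverbindingBudgetAffineCompressedCutStack (inLayer_tadd)
open Summit.AtomisticToContinuum.Crystallization.Theorems.OverbindingBudgetAffineCompressedCutPatch (capv dL inLayer_capv_sub tadd_tadd_assoc)
open Summit.AtomisticToContinuum.Crystallization.Theorems.OverbindingBudgetAffineCompressedCutBudget (tauR dR record_numbers tauR_dR_mono)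
open Summit.AtomisticToContinuum.Crystallization.Theorems.OverbindingBudgetAffineCompressedCutLens (rho0 lens_point level_of_point lens_dist
  sqrt_two_div_two_lt_rho0)
open Summit.AtomisticToContinuum.Crystallization.Theorems.OverbindingBudgetAffineCompressedCutStepA (base_patch_record upper_flip)
open Summit.AtomisticToContinuum.Crystallization.Theorems.OverbindingBudgetAffineCompressedCutGlue (stack_levels_record)
open Summit.AtomisticToContinuum.Crystallization.Theorems.OverbindingBudgetAffineCompressedCutReadingA (copy_shells cap_unique height_budget
  label_sep_budget reach_lens label_sep small_label frame_point level_box read_level not_second_shell)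

variable {N : ℕ}

/-- ★★ **READING OF ONE SITE** against the stacking datum (see the module docstring). [this file] -/
theorem read_site {y : Fin N → EuclideanSpace ℝ (Fin 3)} (hy : Function.Injective y) {i : Fin N} (hν : 0 < nearestDist y i)
    {A : Fin N → (EuclideanSpace ℝ (Fin 3) →ₗ[ℝ] EuclideanSpace ℝ (Fin 3))} {Qf : Fin N → (EuclideanSpace ℝ (Fin 3) →ₗᵢ[ℝ] EuclideanSpace ℝ (Fin 3))}
    {P : Fin N → Finset (EuclideanSpace ℝ (Fin 3))} {f : Fin N → EuclideanSpace ℝ (Fin 3) → EuclideanSpace ℝ (Fin 3)}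
    {B : EuclideanSpace ℝ (Fin 3) →ₗ[ℝ] EuclideanSpace ℝ (Fin 3)}
    (hP : ∀ j, dist (y j) (y i) ≤ 12 * nearestDist y i → (P j = fccTwoShellPattern ∨ P j = hcpTwoShellPattern))
    (hA : ∀ j, dist (y j) (y i) ≤ 12 * nearestDist y i → ∀ v ∈ P j, ‖A j v - Qf j v‖ ≤ 1 / 1000)
    (hf : ∀ j, dist (y j) (y i) ≤ 12 * nearestDist y i → ∀ v ∈ P j,
      f j v ∈ Set.range y ∧ dist (f j v) (y j + nearestDist y j • A j v) ≤ 1 / 10 ^ 4 * nearestDist y j)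
    (hinj : ∀ j, dist (y j) (y i) ≤ 12 * nearestDist y i → Set.InjOn (f j) ↑(P j))
    (hex : ∀ j, dist (y j) (y i) ≤ 12 * nearestDist y i → ∀ m, m ≠ j → dist (y m) (y j) ≤ (3 / 2 + 1 / 450) * nearestDist y j →
      ∃ v ∈ P j, f j v = y m)
    (hB : ∀ z, 399 / 400 * nearestDist y i * ‖z‖ ≤ ‖B z‖) (hBup : ∀ z, ‖B z‖ ≤ 401 / 400 * nearestDist y i * ‖z‖)
    {ref : ℤ → T3} {Cz : ℤ → List T3} {e : ℤ → ℤ}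
    (hLev : ∀ ℓ : ℤ, -5 ≤ ℓ → ℓ ≤ 5 → Cz ℓ ∈ [fccL, fccNegL, hcpL, hcpAltL] ∧ thsum (ref ℓ) = 6 * ℓ ∧ (ref ℓ).2.1 = (ref ℓ).1 ∧
      (3 : ℤ) ∣ ((ref ℓ).2.1 - (ref ℓ).2.2) ∧
      ∀ u : T3, InLayer (tsub (tadd (2 * ℓ, 2 * ℓ, 2 * ℓ) u) (ref ℓ)) → |u.1| ≤ 18 - |ℓ| → |u.2.1| ≤ 18 - |ℓ| → |u.2.2| ≤ 18 - |ℓ| →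
        ∃ k : Fin N, ∃ M : EuclideanSpace ℝ (Fin 3) →ₗᵢ[ℝ] EuclideanSpace ℝ (Fin 3),
          dist (y k) (y i) ≤ 12 * nearestDist y i ∧ 9026 / 10000 * nearestDist y i ≤ nearestDist y k ∧
          nearestDist y k ≤ 10347 / 10000 * nearestDist y i ∧
          Estab y A P B i k M (Cz ℓ) (tadd (2 * ℓ, 2 * ℓ, 2 * ℓ) u) (tauR (nearestDist y i) 31) (dR (nearestDist y i) 31))
    (hPair : ∀ ℓ : ℤ, -5 ≤ ℓ → ℓ ≤ 4 → (e ℓ = 1 ∨ e ℓ = -1) ∧ ref (ℓ + 1) = tadd (ref ℓ) (capv 1 (e ℓ) (1, 1, -2)) ∧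
      (∀ δ ∈ dL, capv 1 (e ℓ) δ ∈ Cz ℓ) ∧ (∀ δ ∈ dL, capv (-1) (-(e ℓ)) δ ∈ Cz (ℓ + 1)))
    {m : Fin N} (hm : dist (y m) (y i) ≤ 106 / 25 * nearestDist y i) :
    ∃ (ℓ : ℤ) (x : T3), -5 ≤ ℓ ∧ ℓ ≤ 5 ∧ InLayer x ∧
      ‖y m - y i - B (mv (tadd (ref ℓ) x))‖ ≤
        dR (nearestDist y i) 31 + 1 / 10 ^ 4 * (10347 / 10000 * nearestDist y i) + tauR (nearestDist y i) 31 ∧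
      9967 / 10000 * (9026 / 10000 * nearestDist y i) ≤ nearestDist y m := by
  set ν := nearestDist y i with hνdef
  have hc₀ : ((1 : ℤ), (1 : ℤ), (-2 : ℤ)) ∈ dL := by decide
  obtain ⟨hτ0, -, -, -⟩ := tauR_dR_mono hν.le (le_refl 31)
  have hhb := height_budget ν
  -- the model point `z` of `m`: `B z = y m − y i`
  obtain ⟨z, hz, hzn⟩ := frame_point hν hB (y m - y i) (by rwa [← dist_eq_norm])
  -- lens point, level, label
  obtain ⟨c, hc, hzc⟩ := lens_point z hzn
  obtain ⟨ℓ, t, hℓ1, hℓ2, ht0, ht1, hh⟩ := level_of_point c hc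
  obtain ⟨-, hth, -, -, -⟩ := hLev ℓ hℓ1 (by linarith)
  obtain ⟨he, href, -, -⟩ := hPair ℓ hℓ1 hℓ2
  have hh' : Real.sqrt 18 * (c 0 + c 1 + c 2) = thsum (ref ℓ) + 6 * t := by rw [hth]; push_cast; linarith
  obtain ⟨q, x, hx, hq, hcq⟩ := lens_dist (ref ℓ) he c ht0 ht1 hh'
  have hq' : ∃ ℓq : ℤ, (ℓq = ℓ ∨ ℓq = ℓ + 1) ∧ q = tadd (ref ℓq) x := by
    rcases hq with h | h
    · exact ⟨ℓ, Or.inl rfl, h⟩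
    · exact ⟨ℓ + 1, Or.inr rfl, by rw [h, href]⟩
  obtain ⟨ℓq, hℓq, hqe⟩ := hq'
  have hℓq1 : -5 ≤ ℓq := by omega
  have hℓq2 : ℓq ≤ 5 := by omega
  obtain ⟨hCzq, hthq, -, -, hsites⟩ := hLev ℓq hℓq1 hℓq2
  have hthq' := hthq
  simp only [thsum] at hthq'
  -- the level box
  set u := tsub q (2 * ℓq, 2 * ℓq, 2 * ℓq) with hu
  have hqu : tadd (2 * ℓq, 2 * ℓq, 2 * ℓq) u = q := tadd_tsub_cancel _ _
  have hu0 : thsum u = 0 := by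
    simp only [hu, hqe, thsum, tsub, tadd]
    linarith [hx.1]
  have hmvq : ‖mv q‖ ≤ 24 / 5 := by
    calc ‖mv q‖ = ‖c - (c - mv q)‖ := by rw [sub_sub_cancel]
      _ ≤ ‖c‖ + ‖c - mv q‖ := norm_sub_le _ _
      _ ≤ 24 / 5 - rho0 + Real.sqrt 2 / 2 := add_le_add hc hcq
      _ ≤ 24 / 5 := by linarith [sqrt_two_div_two_lt_rho0]
  obtain ⟨hu1, hu2, hu3⟩ := level_box hu0 (by rw [hqu]; exact hmvq)
  have hxq : tsub (tadd (2 * ℓq, 2 * ℓq, 2 * ℓq) u) (ref ℓq) = x := by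
    rw [hqu, hqe]
    exact Prod.ext (by simp [tsub, tadd]) (Prod.ext (by simp [tsub, tadd]) (by simp [tsub, tadd]))
  obtain ⟨k, M, hkr, hklo, hkhi, hE⟩ := hsites u (by rw [hxq]; exact hx) hu1 hu2 hu3
  rw [hqu] at hE
  -- `y m` is near the site `k`
  have hzq : ‖z - mv q‖ ≤ 9 / 10 - rho0 + Real.sqrt 2 / 2 := by
    calc ‖z - mv q‖ = ‖z - c + (c - mv q)‖ := by rw [sub_add_sub_cancel]
      _ ≤ ‖z - c‖ + ‖c - mv q‖ := norm_add_le _ _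
      _ ≤ _ := add_le_add hzc hcq
  have hγ : ‖y m - y i - B (mv q)‖ ≤ 401 / 400 * ν * (9 / 10 - rho0 + Real.sqrt 2 / 2) := by
    rw [← hz, ← map_sub]
    exact (hBup _).trans (mul_le_mul_of_nonneg_left hzq (by positivity))
  have hmk : dist (y m) (y k) ≤ 401 / 400 * ν * (9 / 10 - rho0 + Real.sqrt 2 / 2) + dR ν 31 := by
    have ee : y m - y k = (y m - y i - B (mv q)) - (y k - y i - B (mv q)) := by abel
    rw [dist_eq_norm, ee]
    exact (norm_sub_le _ _).trans (add_le_add hγ hE.2.2)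
  have hreach := reach_lens hν
  -- the level of any label read at `m` is `ℓ` or `ℓ + 1`
  have hslab : ∀ (r : T3) (ℓr : ℤ), thsum r = 6 * ℓr →
      ‖y m - y i - B (mv r)‖ ≤ dR ν 31 + 1 / 10 ^ 4 * (10347 / 10000 * ν) + tauR ν 31 → ℓr - ℓ = 0 ∨ ℓr - ℓ = 1 :=
    fun r ℓr hr hrΔ => read_level hν hB hz hzc ht0 ht1 hh hhb hr hrΔ
  by_cases hmk' : m = k
  · -- `m` is the level site `k` itself, label `q`
    subst hmk'
    refine ⟨ℓq, x, hℓq1, hℓq2, hx, ?_, by linarith [hklo]⟩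
    rw [← hqe]
    exact hE.2.2.trans (by nlinarith)
  · -- `m` is a registered neighbour of `k`
    have hmk2 : dist (y m) (y k) ≤ (3 / 2 + 1 / 450) * nearestDist y k := by linarith [hmk, hklo, hreach]
    obtain ⟨v, hv, hfv⟩ := hex k hkr m hmk' hmk2
    obtain ⟨V, hV, hMV⟩ := hE.1.1 v hv
    obtain ⟨hVsq, hVh⟩ := copy_shells _ hCzq V hV
    have hV18 : tsq V = 18 := by
      rcases hVsq with h | h
      · exact h
      exfalso
      have hv2 : ‖v‖ = Real.sqrt 2 := by
        have h2 : ‖mv V‖ ^ 2 = 2 := by rw [norm_mv_sq, h]; norm_num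
        rw [← M.norm_map v, hMV, ← h2, Real.sqrt_sq (norm_nonneg _)]
      have hposv := (hf k hkr v hv).2
      rw [hfv] at hposv
      exact not_second_shell hν (hA k hkr v hv) hposv hv2 hklo hmk
    have hv1 : ‖v‖ = 1 := by rw [← M.norm_map v, hMV]; exact (norm_mv_eq_one_iff V).mpr hV18
    have hpos := child_position hE (hf k hkr) hv hv1 hMV hfv
    have hposΔ : ‖y m - y i - B (mv (tadd q V))‖ ≤ dR ν 31 + 1 / 10 ^ 4 * (10347 / 10000 * ν) + tauR ν 31 :=
      hpos.trans (by linarith [hkhi])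
    have hnnm : 9967 / 10000 * (9026 / 10000 * ν) ≤ nearestDist y m := by
      obtain ⟨-, hlo, -, -⟩ := bond_exact hy hP hA hf hinj hex hkr (hm.trans (by linarith)) hv hv1 hfv
      linarith [hklo]
    rcases hVh hV18 with hVin | h6 | h6
    · -- in-layer neighbour: same level
      refine ⟨ℓq, tadd x V, hℓq1, hℓq2, inLayer_tadd hx hVin, ?_, hnnm⟩
      rw [hqe, tadd_tadd_assoc] at hposΔ
      exact hposΔ
    · -- up-cap neighbour: only at `ℓq = ℓ`, and it is a recorded cap
      have hs := hslab (tadd q V) (ℓq + 1) (by simp only [thsum, tadd, hqe] at h6 ⊢; linarith [hx.1]) hposΔ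
      have hℓqℓ : ℓq = ℓ := by omega
      obtain ⟨heq, hrefq, hcapUq, -⟩ := hPair ℓq (by omega) (by omega)
      obtain ⟨δ, hδ, hVe⟩ := cap_unique (Cz ℓq) hCzq 1 (by simp) (e ℓq) (by rcases heq with h | h <;> simp [h]) hcapUq V hV hV18
        (by simpa using h6)
      refine ⟨ℓq + 1, tadd x (tsub (capv 1 (e ℓq) δ) (capv 1 (e ℓq) (1, 1, -2))), by omega, by omega,
        inLayer_tadd hx (inLayer_capv_sub heq hδ hc₀), ?_, hnnm⟩
      have hlab : tadd q V = tadd (ref (ℓq + 1)) (tadd x (tsub (capv 1 (e ℓq) δ) (capv 1 (e ℓq) (1, 1, -2)))) := by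
        rw [hqe, hVe, hrefq]
        simp only [tadd, tsub, capv, Prod.mk.injEq]
        exact ⟨by ring, by ring, by ring⟩
      rw [hlab] at hposΔ
      exact hposΔ
    · -- down-cap neighbour: only at `ℓq = ℓ + 1`, and it is a recorded reversed cap («Levels».`pair_reverse`)
      have hs := hslab (tadd q V) (ℓq - 1) (by simp only [thsum, tadd, hqe] at h6 ⊢; linarith [hx.1]) hposΔ
      have hℓqℓ : ℓq = ℓ + 1 := by omega
      obtain ⟨heq, hrefq, -, hcapDq⟩ := hPair (ℓq - 1) (by omega) (by omega)
      have e1 : ℓq - 1 + 1 = ℓq := by ring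
      rw [e1] at hrefq hcapDq
      obtain ⟨δ, hδ, hVe⟩ := cap_unique (Cz ℓq) hCzq (-1) (by simp) (-(e (ℓq - 1))) (by rcases heq with h | h <;> simp [h]) hcapDq V hV
        hV18 (by simpa using h6)
      refine ⟨ℓq - 1, tadd x (tsub (capv 1 (e (ℓq - 1)) (1, 1, -2)) (capv 1 (e (ℓq - 1)) δ)), by omega, by omega,
        inLayer_tadd hx (inLayer_capv_sub heq hc₀ hδ), ?_, hnnm⟩
      have hlab : tadd q V = tadd (ref (ℓq - 1)) (tadd x (tsub (capv 1 (e (ℓq - 1)) (1, 1, -2)) (capv 1 (e (ℓq - 1)) δ))) := by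
        rw [hqe, hVe, hrefq]
        simp only [tadd, tsub, capv, Prod.mk.injEq]
        exact ⟨by ring, by ring, by ring⟩
      rw [hlab] at hposΔ
      exact hposΔ

/-- ★★★ **LAYER RIGIDITY LR(r₁)** — the record (see the module docstring). [this file] -/
theorem layer_rigidity_record {y : Fin N → EuclideanSpace ℝ (Fin 3)} (hy : Function.Injective y) {i : Fin N} (hν : 0 < nearestDist y i)
    {A : Fin N → (EuclideanSpace ℝ (Fin 3) →ₗ[ℝ] EuclideanSpace ℝ (Fin 3))} {Qf : Fin N → (EuclideanSpace ℝ (Fin 3) →ₗᵢ[ℝ] EuclideanSpace ℝ (Fin 3))}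
    {P : Fin N → Finset (EuclideanSpace ℝ (Fin 3))} {f : Fin N → EuclideanSpace ℝ (Fin 3) → EuclideanSpace ℝ (Fin 3)}
    (hP : ∀ j, dist (y j) (y i) ≤ 12 * nearestDist y i → (P j = fccTwoShellPattern ∨ P j = hcpTwoShellPattern))
    (hA : ∀ j, dist (y j) (y i) ≤ 12 * nearestDist y i → ∀ v ∈ P j, ‖A j v - Qf j v‖ ≤ 1 / 1000)
    (hf : ∀ j, dist (y j) (y i) ≤ 12 * nearestDist y i → ∀ v ∈ P j,
      f j v ∈ Set.range y ∧ dist (f j v) (y j + nearestDist y j • A j v) ≤ 1 / 10 ^ 4 * nearestDist y j)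
    (hinj : ∀ j, dist (y j) (y i) ≤ 12 * nearestDist y i → Set.InjOn (f j) ↑(P j))
    (hex : ∀ j, dist (y j) (y i) ≤ 12 * nearestDist y i → ∀ m, m ≠ j → dist (y m) (y j) ≤ (3 / 2 + 1 / 450) * nearestDist y j →
      ∃ v ∈ P j, f j v = y m)
    (hBlo : ∀ z, 399 / 400 * nearestDist y i * ‖z‖ ≤ ‖(nearestDist y i • A i) z‖)
    (hBup : ∀ z, ‖(nearestDist y i • A i) z‖ ≤ 401 / 400 * nearestDist y i * ‖z‖) :
    ∃ (s : T3) (hs : IsSign s) (ref : ℤ → T3) (Cz : ℤ → List T3) (e : ℤ → ℤ),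
      (∀ ℓ : ℤ, -5 ≤ ℓ → ℓ ≤ 5 → Cz ℓ ∈ [fccL, fccNegL, hcpL, hcpAltL] ∧ thsum (ref ℓ) = 6 * ℓ ∧ (ref ℓ).2.1 = (ref ℓ).1 ∧
        (3 : ℤ) ∣ ((ref ℓ).2.1 - (ref ℓ).2.2) ∧
        ∀ u : T3, InLayer (tsub (tadd (2 * ℓ, 2 * ℓ, 2 * ℓ) u) (ref ℓ)) → |u.1| ≤ 18 - |ℓ| → |u.2.1| ≤ 18 - |ℓ| → |u.2.2| ≤ 18 - |ℓ| →
          ∃ k : Fin N, ∃ M : EuclideanSpace ℝ (Fin 3) →ₗᵢ[ℝ] EuclideanSpace ℝ (Fin 3),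
            dist (y k) (y i) ≤ 12 * nearestDist y i ∧ 9026 / 10000 * nearestDist y i ≤ nearestDist y k ∧
            nearestDist y k ≤ 10347 / 10000 * nearestDist y i ∧
            Estab y A P ((nearestDist y i • A i) ∘ₗ (flipIso s hs).toLinearMap) i k M (Cz ℓ) (tadd (2 * ℓ, 2 * ℓ, 2 * ℓ) u)
              (tauR (nearestDist y i) 31) (dR (nearestDist y i) 31)) ∧
      (∀ ℓ : ℤ, -5 ≤ ℓ → ℓ ≤ 4 → (e ℓ = 1 ∨ e ℓ = -1) ∧ ref (ℓ + 1) = tadd (ref ℓ) (capv 1 (e ℓ) (1, 1, -2)) ∧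
        (∀ δ ∈ dL, capv 1 (e ℓ) δ ∈ Cz ℓ) ∧ (∀ δ ∈ dL, capv (-1) (-(e ℓ)) δ ∈ Cz (ℓ + 1))) ∧
      (∃ x₀ : T3, InLayer x₀ ∧ tadd (ref 0) x₀ = (0, 0, 0)) ∧
      (∀ m, dist (y m) (y i) ≤ 106 / 25 * nearestDist y i → ∃ (ℓ : ℤ) (x : T3), -5 ≤ ℓ ∧ ℓ ≤ 5 ∧ InLayer x ∧
        ‖y m - y i - ((nearestDist y i • A i) ∘ₗ (flipIso s hs).toLinearMap) (mv (tadd (ref ℓ) x))‖ ≤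
          dR (nearestDist y i) 31 + 1 / 10 ^ 4 * (10347 / 10000 * nearestDist y i) + tauR (nearestDist y i) 31 ∧
        9967 / 10000 * (9026 / 10000 * nearestDist y i) ≤ nearestDist y m) ∧
      (∀ (m m' : Fin N) (r : T3), 9967 / 10000 * (9026 / 10000 * nearestDist y i) ≤ nearestDist y m' →
        ‖y m - y i - ((nearestDist y i • A i) ∘ₗ (flipIso s hs).toLinearMap) (mv r)‖ ≤
          dR (nearestDist y i) 31 + 1 / 10 ^ 4 * (10347 / 10000 * nearestDist y i) + tauR (nearestDist y i) 31 →
        ‖y m' - y i - ((nearestDist y i • A i) ∘ₗ (flipIso s hs).toLinearMap) (mv r)‖ ≤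
          dR (nearestDist y i) 31 + 1 / 10 ^ 4 * (10347 / 10000 * nearestDist y i) + tauR (nearestDist y i) 31 → m = m') ∧
      (∀ (m : Fin N) (ℓ : ℤ) (x : T3) (ℓ' : ℤ) (x' : T3), -5 ≤ ℓ → ℓ ≤ 5 → -5 ≤ ℓ' → ℓ' ≤ 5 → InLayer x → InLayer x' →
        ‖y m - y i - ((nearestDist y i • A i) ∘ₗ (flipIso s hs).toLinearMap) (mv (tadd (ref ℓ) x))‖ ≤
          dR (nearestDist y i) 31 + 1 / 10 ^ 4 * (10347 / 10000 * nearestDist y i) + tauR (nearestDist y i) 31 →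
        ‖y m - y i - ((nearestDist y i • A i) ∘ₗ (flipIso s hs).toLinearMap) (mv (tadd (ref ℓ') x'))‖ ≤
          dR (nearestDist y i) 31 + 1 / 10 ^ 4 * (10347 / 10000 * nearestDist y i) + tauR (nearestDist y i) 31 →
        tadd (ref ℓ) x = tadd (ref ℓ') x') := by
  set ν := nearestDist y i with hνdef
  obtain ⟨s, hs, C₀, j, w, bw, K₀, a, hC₀, hj, hw, -, hbw, hw0, hw12, hw23, hK, hK18, hcov, ha, hbase⟩ :=
    base_patch_record hy hP hA hf hinj hex hν hBup
  set B := (ν • A i) ∘ₗ (flipIso s hs).toLinearMap with hBdef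
  have hB : ∀ z, 399 / 400 * ν * ‖z‖ ≤ ‖B z‖ := lower_flip hs hBlo
  have hBup' : ∀ z, ‖B z‖ ≤ 401 / 400 * ν * ‖z‖ := upper_flip hBup hs
  have hC₀' : C₀ ∈ [fccL, fccNegL, hcpL, hcpAltL] := by rcases hC₀ with h | h | h | h <;> simp [h]
  obtain ⟨ref, Cz, e, hLev, hPair⟩ :=
    stack_levels_record hy hν hP hA hf hinj hex hB hBup' hC₀' hj hw hbw hw0 hw12 hw23 hK hK18 hcov ha hbase
  have hread := fun (m : Fin N) (hm : dist (y m) (y i) ≤ 106 / 25 * ν) => read_site hy hν hP hA hf hinj hex hB hBup' hLev hPair hm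
  obtain ⟨h1, -, -, -, -⟩ := record_numbers hν
  have hlsb := label_sep_budget hν
  refine ⟨s, hs, ref, Cz, e, hLev, hPair, ?_, hread, ?_, ?_⟩
  · -- `i ↦ 0`
    obtain ⟨ℓ, x, hℓ1, hℓ2, hx, hpos, -⟩ := hread i (by rw [dist_self]; positivity)
    rw [sub_self, zero_sub, norm_neg] at hpos
    have hn := (hB _).trans hpos
    have hsq : tsq (tadd (ref ℓ) x) ≤ 2 := by
      have h2 := pow_le_pow_left₀ (by positivity) hn 2
      rw [mul_pow, norm_mv_sq] at h2
      have hpos' : (0 : ℝ) < (399 / 400 * ν) ^ 2 := by positivity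
      have h3 : ((tsq (tadd (ref ℓ) x) : ℤ) : ℝ) < 3 := by
        by_contra hcon
        push Not at hcon
        nlinarith
      have : tsq (tadd (ref ℓ) x) < 3 := by exact_mod_cast h3
      omega
    obtain ⟨-, hth, hr1, hr2, -⟩ := hLev ℓ hℓ1 hℓ2
    obtain ⟨h0, hℓ0⟩ := small_label hth hr1 hr2 hx hsq
    subst hℓ0
    exact ⟨x, hx, h0⟩
  · -- same label ⇒ same site
    intro m m' r hm' h h'
    exact site_eq_of_close h h' (by linarith)
  · -- same site ⇒ same label
    intro m ℓ x ℓ' x' hℓ1 hℓ2 hℓ1' hℓ2' hx hx' h h'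
    by_contra hne
    obtain ⟨-, hth, -, -, -⟩ := hLev ℓ hℓ1 hℓ2
    obtain ⟨-, hth', -, -, -⟩ := hLev ℓ' hℓ1' hℓ2'
    have hsep := label_sep hth hth' (fun hh => congrArg ref hh) hx hx' hne
    have hd : ‖B (mv (tsub (tadd (ref ℓ) x) (tadd (ref ℓ') x')))‖ ≤
        2 * (dR ν 31 + 1 / 10 ^ 4 * (10347 / 10000 * ν) + tauR ν 31) := by
      rw [mv_tsub, map_sub]
      have ee : B (mv (tadd (ref ℓ) x)) - B (mv (tadd (ref ℓ') x')) =
          (y m - y i - B (mv (tadd (ref ℓ') x'))) - (y m - y i - B (mv (tadd (ref ℓ) x))) := by abel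
      rw [ee]
      exact (norm_sub_le _ _).trans (by linarith)
    have hn := (hB _).trans hd
    have h2 := pow_le_pow_left₀ (by positivity) hn 2
    rw [mul_pow, norm_mv_sq] at h2
    have h12 : (12 : ℝ) ≤ ((tsq (tsub (tadd (ref ℓ) x) (tadd (ref ℓ') x')) : ℤ) : ℝ) := by exact_mod_cast hsep
    have hpos' : (0 : ℝ) < (399 / 400 * ν) ^ 2 := by positivity
    nlinarith

end Summit.AtomisticToContinuum.Crystallization.Theorems.OverbindingBudgetAffineCompressedCutReading
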